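import Summits.Ventures.QEC.Census.LRATLeavesBB
import HarnessLib

/-!
# Kernel-B certificates for bivariate-bicycle codes, `X` side: `le_hammingNorm_xLogical_of_kernelB_pinned`

Cell `qec`, PARTITION v2 row type-11 — the `X ↔ Z` exchange of `Census/LRATLeavesBB.lean`: from the
`X`-side pinned `enc-v2` leaves (`H = HZFlat` row supports, `L = LZ`, cases «bit 0» / «left block clear,
bit `ℓm`»; qec-search-2 cert 2329a660016ec77c, leaf modules `Census/BB/BB72KBLeavesX*.lean`) every
`X`-logical of `QC(A,B)` (`H^Z v = 0`, `v ∉ rs H^X`) has weight `≥ d`.  The pin comes from type-12's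
`BB.Code.exists_xLogical_pinned` (`TwoBlockOrbitReduction.lean`, `Mono ⊕ Mono` indexing), transported to
flat indices by `HZFlat_mulVec_eq_zero_iff` / `mem_rowSpace_HXFlat_iff` / `forall_inl_eq_zero_iff`.
With `BB.Code.le_dX_of_pinned` this gives `d ≤ d^X` — an independent kernel certificate of the `X`-distance
(for `QC(A,B)` `d^X = d^Z`, Lemma 1, so this re-derives the distance through the other 72 leaves).
-/

namespace Literature.InformationTheory.QuantumCodes.BB.Code

open Matrix Std.Sat Summit.Ventures.QEC.Census.CNFEncode Summit.Ventures.QEC.Census.LRATBridge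

variable {ℓ m : ℕ} [NeZero ℓ] [NeZero m] (C : Code ℓ m)

/-- **Kernel-B pinned lower bound, `X` side, flat**: every flat `X`-logical `w` (`HZFlat w = 0`,
`w ∉ rs HXFlat`) in one of the two translation cases has weight `≥ d`, given the `X`-side leaf UNSATs
(`rows` = row supports of `HZFlat`, `us` = supports of a `Z`-logical family `LZ`), the two coverage
facts, coordinate literals, and `hlog` (every flat `X`-logical meets some `LZ_j` oddly). -/
theorem le_hammingNorm_of_kernelB_pinned_X {d k : ℕ} (LZ : Fin k → Fin (ℓ * m + ℓ * m) → ZMod 2)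
    (hlog : ∀ v : Fin (ℓ * m + ℓ * m) → ZMod 2, C.HZFlat *ᵥ v = 0 → v ∉ rowSpace C.HXFlat →
      ∃ j, LZ j ⬝ᵥ v ≠ 0)
    (rows us : List (List ℕ)) (hrows : rowSupports C.HZFlat = rows) (hus : supports LZ = us)
    (cubes₀ cubes₁ : List (List (Literal ℕ)))
    (hleaf₀ : ∀ q ∈ cubes₀, (leafCNF (ℓ * m + ℓ * m) rows us (d - 1) [] q).Unsat)
    (hleaf₁ : ∀ q ∈ cubes₁, (leafCNF (ℓ * m + ℓ * m) rows us (d - 1) (pinZeros (ℓ * m)) q).Unsat)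
    (hcover₀ : (coverCNF 0 cubes₀).Unsat) (hcover₁ : (coverCNF (ℓ * m) cubes₁).Unsat)
    (hlits₀ : ∀ q ∈ cubes₀, ∀ l ∈ q, l.1 < ℓ * m + ℓ * m)
    (hlits₁ : ∀ q ∈ cubes₁, ∀ l ∈ q, l.1 < ℓ * m + ℓ * m)
    (w : Fin (ℓ * m + ℓ * m) → ZMod 2) (hw : C.HZFlat *ᵥ w = 0) (hw' : w ∉ rowSpace C.HXFlat)
    (hpin : w (qubitIndex (Sum.inl 0)) ≠ 0 ∨
      ((∀ i : Fin (ℓ * m + ℓ * m), (i : ℕ) < ℓ * m → w i = 0) ∧ w (qubitIndex (Sum.inr 0)) ≠ 0)) :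
    d ≤ hammingNorm w := by
  subst hrows hus
  by_contra hlt
  have hsol : SolvesAny (ℓ * m + ℓ * m) (rowSupports C.HZFlat) (supports LZ) (d - 1) (toAssign w) :=
    solvesAny_of_vector C.HZFlat LZ w hw (hlog w hw hw') (by omega)
  have hr := rowSupports_lt C.HZFlat
  have hu := supports_lt LZ
  rcases hpin with h0 | ⟨hzero, h1⟩
  · have ha0 : toAssign w 0 = true := by
      have := toAssign_eq_true_of_ne w _ h0
      rwa [qubitIndex_inl_zero_val] at this
    obtain ⟨q, hq, hsat⟩ := cover_of_unsat hcover₀ (toAssign w) ha0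
    exact not_solvesAny_of_leaf hr hu [] q (by simp) (hlits₀ q hq) (hleaf₀ q hq) (toAssign w)
      (fun _ h => by simp at h) hsat hsol
  · have ha1 : toAssign w (ℓ * m) = true := by
      have := toAssign_eq_true_of_ne w _ h1
      rwa [qubitIndex_inr_zero_val] at this
    obtain ⟨q, hq, hsat⟩ := cover_of_unsat hcover₁ (toAssign w) ha1
    exact not_solvesAny_of_leaf hr hu (pinZeros (ℓ * m)) q (pinZeros_lt (by omega)) (hlits₁ q hq)
      (hleaf₁ q hq) (toAssign w) (satLits_pinZeros w (by omega) hzero) hsat hsol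

/-- **Route-style shape, `X` side**: every `X`-logical of `C.css` (`H^Z v = 0`, `v ∉ rs H^X`, `Mono ⊕ Mono`
indexing) has weight `≥ d`, from the `X`-side pinned kernel-B certificate data (pin by type-12's
`exists_xLogical_pinned`). -/
theorem le_hammingNorm_xLogical_of_kernelB_pinned {d k : ℕ}
    (LZ : Fin k → Fin (ℓ * m + ℓ * m) → ZMod 2)
    (hlog : ∀ v : Fin (ℓ * m + ℓ * m) → ZMod 2, C.HZFlat *ᵥ v = 0 → v ∉ rowSpace C.HXFlat →
      ∃ j, LZ j ⬝ᵥ v ≠ 0)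
    (rows us : List (List ℕ)) (hrows : rowSupports C.HZFlat = rows) (hus : supports LZ = us)
    (cubes₀ cubes₁ : List (List (Literal ℕ)))
    (hleaf₀ : ∀ q ∈ cubes₀, (leafCNF (ℓ * m + ℓ * m) rows us (d - 1) [] q).Unsat)
    (hleaf₁ : ∀ q ∈ cubes₁, (leafCNF (ℓ * m + ℓ * m) rows us (d - 1) (pinZeros (ℓ * m)) q).Unsat)
    (hcover₀ : (coverCNF 0 cubes₀).Unsat) (hcover₁ : (coverCNF (ℓ * m) cubes₁).Unsat)
    (hlits₀ : ∀ q ∈ cubes₀, ∀ l ∈ q, l.1 < ℓ * m + ℓ * m)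
    (hlits₁ : ∀ q ∈ cubes₁, ∀ l ∈ q, l.1 < ℓ * m + ℓ * m)
    (v : Mono ℓ m ⊕ Mono ℓ m → ZMod 2) (hv : C.css.HZ *ᵥ v = 0) (hv' : v ∉ C.css.rowSpX) :
    d ≤ hammingNorm v := by
  -- pin in `Mono ⊕ Mono` indexing, then flatten the pinned logical
  obtain ⟨v', h₁, h₂, hwt, hpin⟩ := C.exists_xLogical_pinned hv hv'
  let u : Fin (ℓ * m + ℓ * m) → ZMod 2 := v' ∘ qubitIndex.symm
  have hcomp : u ∘ (qubitIndex (ℓ := ℓ) (m := m)) = v' := by funext q; simp [u]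
  have hu : C.HZFlat *ᵥ u = 0 := (C.HZFlat_mulVec_eq_zero_iff _).2 (by rw [hcomp]; exact h₁)
  have hu' : u ∉ rowSpace C.HXFlat := fun h => by
    have h' := (C.mem_rowSpace_HXFlat_iff _).1 h
    rw [hcomp] at h'
    exact h₂ h'
  have hpin' : u (qubitIndex (Sum.inl 0)) ≠ 0 ∨
      ((∀ i : Fin (ℓ * m + ℓ * m), (i : ℕ) < ℓ * m → u i = 0) ∧ u (qubitIndex (Sum.inr 0)) ≠ 0) := by
    rcases hpin with h0 | ⟨hz, h1⟩
    · left; simpa [u] using h0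
    · right
      refine ⟨(forall_inl_eq_zero_iff u).1 (fun x => by simpa [u] using hz x), by simpa [u] using h1⟩
  have h := C.le_hammingNorm_of_kernelB_pinned_X LZ hlog rows us hrows hus cubes₀ cubes₁ hleaf₀ hleaf₁
    hcover₀ hcover₁ hlits₀ hlits₁ u hu hu' hpin'
  rw [BB.hammingNorm_comp_equiv v' qubitIndex.symm, hwt] at h
  exact h

/-- **`d ≤ d^X` from the `X`-side pinned kernel-B certificate** (via type-12's `le_dX_of_pinned`'s
existence guard `hex`: some `X`-logical exists). -/
theorem le_dX_of_kernelB_pinned {d k : ℕ} (LZ : Fin k → Fin (ℓ * m + ℓ * m) → ZMod 2)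
    (hlog : ∀ v : Fin (ℓ * m + ℓ * m) → ZMod 2, C.HZFlat *ᵥ v = 0 → v ∉ rowSpace C.HXFlat →
      ∃ j, LZ j ⬝ᵥ v ≠ 0)
    (rows us : List (List ℕ)) (hrows : rowSupports C.HZFlat = rows) (hus : supports LZ = us)
    (cubes₀ cubes₁ : List (List (Literal ℕ)))
    (hleaf₀ : ∀ q ∈ cubes₀, (leafCNF (ℓ * m + ℓ * m) rows us (d - 1) [] q).Unsat)
    (hleaf₁ : ∀ q ∈ cubes₁, (leafCNF (ℓ * m + ℓ * m) rows us (d - 1) (pinZeros (ℓ * m)) q).Unsat)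
    (hcover₀ : (coverCNF 0 cubes₀).Unsat) (hcover₁ : (coverCNF (ℓ * m) cubes₁).Unsat)
    (hlits₀ : ∀ q ∈ cubes₀, ∀ l ∈ q, l.1 < ℓ * m + ℓ * m)
    (hlits₁ : ∀ q ∈ cubes₁, ∀ l ∈ q, l.1 < ℓ * m + ℓ * m)
    (hex : ∃ v : Mono ℓ m ⊕ Mono ℓ m → ZMod 2, C.HZ *ᵥ v = 0 ∧ v ∉ rowSpace C.HX) : d ≤ C.css.dX :=
  C.css.le_dX hex fun v hv hv' =>
    C.le_hammingNorm_xLogical_of_kernelB_pinned LZ hlog rows us hrows hus cubes₀ cubes₁ hleaf₀ hleaf₁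
      hcover₀ hcover₁ hlits₀ hlits₁ v hv hv'

end Literature.InformationTheory.QuantumCodes.BB.Code
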